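import Summits.BirchSwinnertonDyer.Rank1Residual.AdditivePotMult.ManinConstantDegree
import Summits.BirchSwinnertonDyer.Rank1Residual.AdditivePotMult.RankOneIrreducibleShaCertificate
import HarnessLib

/-!
# X4(M), rank one, `p ∣ #Ш_an`: the index-VALUATION + Ш-certificate lever WITHOUT the Manin constant
# (the datum `p ∤ c(D)` from `p ∤ deg(D)`, Česnavičius–Neururer–Saha 2024 Thm. 1.2 + tameness of (M))

HONEST FRAMING (cell `b2b-bsdres`, run/shared/lean/b2b/bsd-rank1-residual/, verbatim in every
file): the goal of the cell is to DELETE the COMBINATION-SHAPED residual classes of the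
Birch–Swinnerton-Dyer formula for ALL analytic-rank `≤ 1` elliptic curves over `ℚ` — "full BSD
formula for every rank `≤ 1` curve in class `C`" assembled STRICTLY from published theorems — so
that the rank-`≤ 1` remainder becomes exactly the CONSTRUCTION-SHAPED classes, which are TYPED
(missing-input `Prop`s), NOT attempted. This is not "finishing BSD". Sub-cell `additive-p1`
(CLASS-OWNERS row "X3/X4 additive — pot. multiplicative / X3♯(M)"), generation 15: research route;
no claim beyond the stated classes; theorems only, no definition, no new named fact (`hCNS` = A159
enters as a hypothesis); X3♯(M) and X4(M) stay CONSTRUCTION-SHAPED; no label moves; nothing booked.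

WHAT THIS FILE DOES. Gen 13's per-pair lever `ClassX4M.bsdp_rankOne_of_indexValuation_of_pow_dvd`
/ `…_of_exists_torsion` (`RankOneIrreducibleShaCertificate.lean`, p246817: `r_an(E) = 1`, `E[p]`
irreducible NOT necessarily surjective, Heegner field `K` with `d_K` odd and `< −4`, unit twist value,
`p ∤ ∏c_ℓ(E)`, two-engine index VALUATION `ord_p [E(K) : ℤP] ≤ k`, and a descent certificate
`p^{2k−1} ∣ #Ш(E)` — for `k = 1` ONE non-zero `p`-torsion class of `Ш(E)` — ⟹ `BSD(E,p)` AND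
`BSD(E^{(d_K)},p)`, by Matar–Nekovář 2019 Thm. 0.3 + Gross–Zagier + Cassels–Tate) carries the Manin
datum `p ∤ c(Dt)` of the Gross–Zagier formula. On the (M) cells at every odd `p` that datum follows
from `p ∤ deg(Dt)` (`ManinConstantDegree.lean` §2: Česnavičius–Neururer–Saha, JEMS 26 (2024) Thm. 1.2
as the named fact A159 `hCNS`, + `PotMult.condExpTwo_of_odd`: the printed exceptional clause at `3`
needs `3³ ∣ N`, impossible on (M)). This file records the two compositions, completing gen 14's
Manin-free family (index CERTIFICATE `…_of_indexCertificate_of_not_dvd_modularDegree`, index BALANCE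
`…_of_indexBalance_of_noPTorsion_of_not_dvd_modularDegree`) with the index VALUATION member — the
reading of the rank-one (M) rows with `9 ∣ #Ш_an` and Cremona optimality code `≥ 2` (REPORT §17
list D ∩ #Ш_an = 9; e.g. n1011 ROUTE-3 l.110's six (M) 'SHA3' rows), whose certificate is then
'`3 ∤ deg φ` of ANY member's conductor-level parametrisation + two-engine `ord₃ m = 1` + one exhibited
exact 3-Selmer element beyond `E(ℚ)/3`', with NO optimality / Manin-`1` entry.

References: [CesnaviciusNeururerSaha2023] Thm. 1.2; [MatarNekovar2019] Thm. 0.3; [GrossZagier1986];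
[Cassels1962ArithmeticIV]; [Miller2011LMS] Def. 1.1.
-/

noncomputable section

open scoped Classical NumberField

open WeierstrassCurve NumberField Literature.NumberTheory.EllipticCurves
  Literature.NumberTheory.EllipticCurves.ModularForms
  Literature.NumberTheory.EllipticCurves.Rank1Residual
  Literature.NumberTheory.EllipticCurves.Rank1Residual.Typed

namespace Summit.BirchSwinnertonDyer.Rank1Residual.AdditivePotMult

variable {W : WeierstrassCurve ℚ} [W.IsElliptic] [W.IsGloballyMinimal] {p : ℕ} [hp : Fact p.Prime]

/-- **X4(M), rank one, ANY odd `p`, ANY irreducible image, NO Manin constant: `BSD(E,p) ∧ BSD(E^{(d_K)},p)`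
from the index VALUATION `ord_p [E(K):ℤP] ≤ k`, the unit twist value, `p ∤ ∏c_ℓ(E)` and the
certificate `p^{2k−1} ∣ #Ш(E)`** — gen 13's `ClassX4M.bsdp_rankOne_of_indexValuation_of_pow_dvd` with
`p ∤ c(Dt)` replaced by `p ∤ deg(Dt)`. Named facts `hGZ` `hKo` `hMN` `hGZK` `hmod` `hCT` `hCNS`.
[cite: CesnaviciusNeururerSaha2023, Thm. 1.2] [cite: MatarNekovar2019, Thm. 0.3]
[cite: Miller2011LMS, §1 and Def. 1.1] -/
theorem ClassX4M.bsdp_rankOne_of_indexValuation_of_pow_dvd_of_not_dvd_modularDegree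
    [NeZero (W.conductorNorm ℤ)]
    (hCNS : cesnaviciusNeururerSaha_padicVal_maninConstant_le_modularDegree)
    (hX : ClassX4M W p) (hr : W.analyticRank = 1)
    (K : Type) [Field K] [NumberField K]
    (Dt : ModularParametrizationData W (W.conductorNorm ℤ))
    (H : HeegnerDatum (W.conductorNorm ℤ) (NumberField.discr K)) (ι : K →+* ℂ)
    (P : (W.baseChange K).toAffine.Point)
    (hGZ : gross_zagier (W.conductorNorm ℤ) W K) (hKo : kolyvagin (W.conductorNorm ℤ) W K)
    (hMN : MatarNekovar2019.thm03_padicValNat_card_sha_le_of_irreducible (W.conductorNorm ℤ) W K)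
    (hGZK : rank_eq_analyticRank_of_analyticRank_le_one) (hmod : hasEntireLFunction_rat)
    (hCT : exists_casselsTate_pairing (K := ℚ))
    (hK : IsImaginaryQuadratic K) (hHN : SatisfiesHeegnerHypothesis (W.conductorNorm ℤ) K)
    (hodd : Odd (NumberField.discr K)) (hdK : NumberField.discr K < -4)
    (hP : WeierstrassCurve.Affine.Point.map ι.toRatAlgHom P = heegnerPointComplex Dt H)
    (hdeg : ¬ p ∣ Dt.modularDegree)
    (Wd : WeierstrassCurve ℚ) [Wd.IsElliptic] [Wd.IsGloballyMinimal] (Cd : VariableChange ℚ)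
    (hWd : Cd • W.quadraticTwist (NumberField.discr K : ℚ) = Wd)
    (qd : ℚ) (hqd : Wd.entireLFunction 1 / (Wd.realPeriodRat : ℂ) = (qd : ℂ)) (hqd0 : qd ≠ 0)
    (hvd : padicValRat p qd = 0) (htam : ¬ p ∣ W.tamagawaProduct)
    {k : ℕ} (hI : padicValNat p (AddSubgroup.zmultiples P).index ≤ k)
    (hSha : p ^ (2 * k - 1) ∣ W.shaOrder) :
    BSDp W p ∧ BSDp Wd p :=
  hX.bsdp_rankOne_of_indexValuation_of_pow_dvd hr K Dt H ι P hGZ hKo hMN hGZK hmod hCT hK hHN hodd hdK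
    hP (hX.not_dvd_maninConstant_of_not_dvd_modularDegree hCNS Dt hdeg) Wd Cd hWd qd hqd hqd0 hvd htam
    hI hSha

/-- **X4(M), rank one, ANY odd `p`, ANY irreducible image, NO Manin constant, `k = 1`: `BSD(E,p) ∧
BSD(E^{(d_K)},p)` from `ord_p [E(K):ℤP] ≤ 1`, the unit twist value, `p ∤ ∏c_ℓ(E)` and ONE non-zero
`x ∈ Ш(E)` with `p·x = 0`** — gen 13's `ClassX4M.bsdp_rankOne_of_indexValuation_of_exists_torsion` with
`p ∤ c(Dt)` replaced by `p ∤ deg(Dt)` (the (M) rank-one `#Ш_an = 9` rows at `p = 3` with optimality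
code `≥ 2`: certificate = `3 ∤ deg φ` + two-engine `ord₃ m = 1` + one exhibited exact 3-Selmer element
beyond `E(ℚ)/3E(ℚ)`). Named facts `hGZ` `hKo` `hMN` `hGZK` `hmod` `hCT` `hCNS`.
[cite: CesnaviciusNeururerSaha2023, Thm. 1.2] [cite: MatarNekovar2019, Thm. 0.3]
[cite: Miller2011LMS, §1 and Def. 1.1] -/
theorem ClassX4M.bsdp_rankOne_of_indexValuation_of_exists_torsion_of_not_dvd_modularDegree
    [NeZero (W.conductorNorm ℤ)]
    (hCNS : cesnaviciusNeururerSaha_padicVal_maninConstant_le_modularDegree)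
    (hX : ClassX4M W p) (hr : W.analyticRank = 1)
    (K : Type) [Field K] [NumberField K]
    (Dt : ModularParametrizationData W (W.conductorNorm ℤ))
    (H : HeegnerDatum (W.conductorNorm ℤ) (NumberField.discr K)) (ι : K →+* ℂ)
    (P : (W.baseChange K).toAffine.Point)
    (hGZ : gross_zagier (W.conductorNorm ℤ) W K) (hKo : kolyvagin (W.conductorNorm ℤ) W K)
    (hMN : MatarNekovar2019.thm03_padicValNat_card_sha_le_of_irreducible (W.conductorNorm ℤ) W K)
    (hGZK : rank_eq_analyticRank_of_analyticRank_le_one) (hmod : hasEntireLFunction_rat)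
    (hCT : exists_casselsTate_pairing (K := ℚ))
    (hK : IsImaginaryQuadratic K) (hHN : SatisfiesHeegnerHypothesis (W.conductorNorm ℤ) K)
    (hodd : Odd (NumberField.discr K)) (hdK : NumberField.discr K < -4)
    (hP : WeierstrassCurve.Affine.Point.map ι.toRatAlgHom P = heegnerPointComplex Dt H)
    (hdeg : ¬ p ∣ Dt.modularDegree)
    (Wd : WeierstrassCurve ℚ) [Wd.IsElliptic] [Wd.IsGloballyMinimal] (Cd : VariableChange ℚ)
    (hWd : Cd • W.quadraticTwist (NumberField.discr K : ℚ) = Wd)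
    (qd : ℚ) (hqd : Wd.entireLFunction 1 / (Wd.realPeriodRat : ℂ) = (qd : ℂ)) (hqd0 : qd ≠ 0)
    (hvd : padicValRat p qd = 0) (htam : ¬ p ∣ W.tamagawaProduct)
    (hI : padicValNat p (AddSubgroup.zmultiples P).index ≤ 1)
    (hx : ∃ x : W.sha, x ≠ 0 ∧ p • x = 0) :
    BSDp W p ∧ BSDp Wd p :=
  hX.bsdp_rankOne_of_indexValuation_of_exists_torsion hr K Dt H ι P hGZ hKo hMN hGZK hmod hCT hK hHN
    hodd hdK hP (hX.not_dvd_maninConstant_of_not_dvd_modularDegree hCNS Dt hdeg) Wd Cd hWd qd hqd hqd0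
    hvd htam hI hx

end Summit.BirchSwinnertonDyer.Rank1Residual.AdditivePotMult

end
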